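import Mathlib.Analysis.Calculus.BumpFunction.InnerProduct
import Mathlib.Analysis.Calculus.Deriv.Support
import Mathlib.Analysis.Calculus.Deriv.MeanValue
import Mathlib.Geometry.Manifold.Instances.Sphere
import Literature.Topology.FourManifolds.ConnectedSum
import Literature.Topology.FourManifolds.ClosedBallProofs
import Literature.Topology.FourManifolds.CerfGammaFourProofs
import Literature.Topology.FourManifolds.SmoothEmbeddingCriteria
import HarnessLib

/-!
# A manifold containing a neck across which two capped pieces are glued is their connected sum

"Connected sum is the operation of joining two manifolds by a tube" (Kosinski, *Differential
Manifolds*, Ch. VI §1, p. 90, and Prop. 1.3: the tube picture of `M₁ # M₂`). This file proves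
the corresponding recognition principle for the tree's relational connected sum
`Literature.Topology.FourManifolds.IsConnectedSum` (`Literature/Topology/FourManifolds/ConnectedSum.lean`), in the form in
which it is used to read off connected-sum decompositions from surgeries along necks — R.
Hamilton, *Four-manifolds with positive isotropic curvature*, Comm. Anal. Geom. 5 (1997), §1.1,
p. 4: "we can then recover the original manifold by … doing surgeries replacing two `B⁴`'s with
an `S³ × B¹`", and B.-L. Chen, X.-P. Zhu, J. Differential Geom. 74 (2006), §5 (arXiv p. 25):
"`M⁴` is diffeomorphic to a connected sum of `Ω̄ⱼ` … (which correspond to glue a tube to two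
boundary components)".

**Neck presentation.** Let `P` be a manifold containing a *neck*: a smooth embedding
`ψ : Sⁿ × ℝ → P` with open range (`Sⁿ ⊂ E` the unit sphere of a real inner product space `E`
of dimension `n + 1`, the model vector space of `P`). Let `M₁`, `M₂` be manifolds with "discs"
`c₁ : E → M₁`, `c₂ : E → M₂`, and let `e₁ : M₁ ∖ {c₁ 0} → P`, `e₂ : M₂ ∖ {c₂ 0} → P` be smooth
embeddings with open, disjoint ranges which miss the middle sphere `ψ (Sⁿ × {0})` and together
with it cover `P`, and which map the punctured discs onto the two halves of the neck in polar
coordinates: `e₁ (c₁ (t • θ)) = ψ (θ, t)` and `e₂ (c₂ (t • θ)) = ψ (θ, -t)` for `t > 0`. (This is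
exactly the situation after cutting `P` along `ψ (Sⁿ × {0})` and capping the two ends by the
discs `c₁`, `c₂`, i.e. `M₁ ⊔ M₂` is obtained from `P` by surgery along the middle sphere and `P`
from `M₁ ⊔ M₂` by surgery along the `0`-sphere `{c₁ 0, c₂ 0}`; Kosinski VI §9.)

**Main results.**

* `Literature.Topology.FourManifolds.isOpenGluing_connectedSumRel_of_neck`: under a neck presentation, `P` is the open gluing
  of `M₁ ∖ {c₁ 0}` and `M₂ ∖ {c₂ 0}` along Kervaire–Milnor's connected-sum relation
  `c₁ (t • u) ∼ c₂ ((1 - t) • u)` (`0 < t < 1`, `‖u‖ = 1`) of the *same* discs `c₁`, `c₂`;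
* `Literature.Topology.FourManifolds.isConnectedSum_of_neck`: hence, if `c₁`, `c₂` are smooth embeddings,
  `IsConnectedSum IP IM IN M₁ M₂ P` — `P ≅ M₁ # M₂`;
* `Literature.Topology.FourManifolds.isConnectedSum_of_neck'`: the same with the punctured pieces `Mᵢ ∖ {cᵢ 0}` presented by
  arbitrary manifolds `Aᵢ` through open smooth embeddings `kᵢ : Aᵢ → Mᵢ` (the form delivered by a
  pushout construction of the capped pieces, `Literature.Topology.FourManifolds.SmoothGlueData`), using
  `Literature.Topology.FourManifolds.diffeomorphOntoOpens` (an open smooth embedding is a diffeomorphism onto its range).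

**Proof.** The given embeddings `e₁`, `e₂` have disjoint ranges, whereas the connected sum needs
the two punctured discs to overlap along an annulus. We post-compose them with two *neck
slides*: diffeomorphisms `Φ∓` of `P` supported in the neck, `Φ∓ (ψ (θ, t)) = ψ (θ, t ∓ Ω t)` for
a smooth compactly supported `Ω : ℝ → [0, ½]` with `Ω = ½` on `[-3, 3]` and `|Ω'| ≤ ⅛`
(`Literature.Topology.FourManifolds.NeckSlide.Ω`, a rescaled bump; `t ↦ t ∓ Ω t` is then a diffeomorphism of `ℝ`,
`Literature.Topology.FourManifolds.NeckSlide.slideDiffeo`, and the slide `Literature.Topology.FourManifolds.exists_neckSlide` is a diffeomorphism of `P`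
equal to the identity off a compact part of the neck). Then `jA := Φ₋ ∘ e₁` and `jB := Φ₊ ∘ e₂`
are open smooth embeddings (`Manifold.IsSmoothEmbedding.diffeomorph_comp`,
`ClosedBallProofs.lean`) with `jA (c₁ (t • u)) = ψ (u, t - ½)` and `jB (c₂ (s • u)) = ψ (u, ½ - s)`
for `0 < t, s ≤ 3`; these agree iff `s = 1 - t` with `0 < t < 1`, which is the connected-sum
relation, and the ranges `… ⊔ ψ (Sⁿ × (-½, ∞))`, `… ⊔ ψ (Sⁿ × (-∞, ½))` cover `P`. No
smoothness in polar coordinates is ever needed: the discs enter only pointwise.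

## References

* A. Kosinski, *Differential Manifolds*, Academic Press (1993), Ch. VI §1 (p. 90, Prop. 1.3),
  §9 (p. 112, surgery). [Kosinski1993]
* R. S. Hamilton, *Four-manifolds with positive isotropic curvature*, Comm. Anal. Geom. 5 (1997)
  1–92, §1.1, pp. 3–4. [Hamilton1997]
* B.-L. Chen, X.-P. Zhu, *Ricci flow with surgery on four-manifolds with positive isotropic
  curvature*, J. Differential Geom. 74 (2006) 177–264, §5 (arXiv:math/0504478, p. 25).
  [ChenZhu2006]
* M. Kervaire, J. Milnor, *Groups of homotopy spheres I*, Ann. of Math. 77 (1963), §2.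
  [KervaireMilnor1963]
-/

open scoped Manifold ContDiff Topology
open Set Function Metric Filter Topology Module

noncomputable section

namespace Literature.Topology.FourManifolds

/-! ### The slide profile on the line -/

namespace NeckSlide

/-- A fixed smooth bump on the line: `= 1` on `[-1, 1]`, `= 0` off `(-2, 2)`, values in `[0, 1]`
(Mathlib's `ContDiffBump`). [folklore] -/
def bump : ContDiffBump (0 : ℝ) := ⟨1, 2, one_pos, one_lt_two⟩

/-- `bump.rIn = 1`. [folklore] -/
theorem bump_rIn : bump.rIn = 1 := rfl

/-- `bump.rOut = 2`. [folklore] -/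
theorem bump_rOut : bump.rOut = 2 := rfl

/-- The derivative of the bump is bounded (it is continuous with compact support). [folklore] -/
theorem exists_abs_deriv_bump_le : ∃ C : ℝ, 0 ≤ C ∧ ∀ t, |deriv (bump : ℝ → ℝ) t| ≤ C := by
  obtain ⟨C, hC⟩ := ((bump.contDiff (n := 1)).continuous_deriv le_rfl).bounded_above_of_compact_support
    bump.hasCompactSupport.deriv
  refine ⟨max C 0, le_max_right _ _, fun t => ?_⟩
  rw [← Real.norm_eq_abs]
  exact (hC t).trans (le_max_left _ _)

/-- A bound `C ≥ 0` for `|bump'|` (chosen once and for all). [folklore] -/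
def derivBound : ℝ := Classical.choose exists_abs_deriv_bump_le

/-- Defining property of `derivBound`. [folklore] -/
theorem derivBound_spec : 0 ≤ derivBound ∧ ∀ t, |deriv (bump : ℝ → ℝ) t| ≤ derivBound :=
  Classical.choose_spec exists_abs_deriv_bump_le

/-- The scale `L = max 3 (4C + 4)` at which the bump is spread out, so that the rescaled bump has
derivative at most `¼` and is constant on `[-3, 3]`. [folklore] -/
def scale : ℝ := max 3 (4 * derivBound + 4)

/-- `3 ≤ L`. [folklore] -/
theorem three_le_scale : 3 ≤ scale := le_max_left _ _

/-- `0 < L`. [folklore] -/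
theorem scale_pos : 0 < scale := by linarith [three_le_scale]

/-- `C / L ≤ ¼`. [folklore] -/
theorem derivBound_div_scale_le : derivBound / scale ≤ 1 / 4 := by
  rw [div_le_iff₀ scale_pos]
  have h := le_max_right 3 (4 * derivBound + 4)
  change 4 * derivBound + 4 ≤ scale at h
  linarith [derivBound_spec.1]

/-- **The slide amount** `Ω t = ½ · bump (t / L)`: smooth, compactly supported, `0 ≤ Ω ≤ ½`,
`Ω = ½` on `[-L, L] ⊇ [-3, 3]`, `Ω = 0` for `|t| ≥ 2L`, and `|Ω'| ≤ ⅛`. [folklore] -/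
def Ω (t : ℝ) : ℝ := 1 / 2 * bump (t / scale)

/-- `Ω` is smooth. [folklore] -/
theorem contDiff_Ω : ContDiff ℝ ∞ Ω :=
  contDiff_const.mul (bump.contDiff.comp (contDiff_id.div_const _))

/-- `0 ≤ Ω`. [folklore] -/
theorem Ω_nonneg (t : ℝ) : 0 ≤ Ω t := by
  have := bump.nonneg (x := t / scale)
  unfold Ω; positivity

/-- `Ω ≤ ½`. [folklore] -/
theorem Ω_le_half (t : ℝ) : Ω t ≤ 1 / 2 := by
  have := bump.le_one (x := t / scale)
  unfold Ω; linarith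

/-- `Ω = ½` on `[-L, L]`. [folklore] -/
theorem Ω_eq_half {t : ℝ} (ht : |t| ≤ scale) : Ω t = 1 / 2 := by
  unfold Ω
  rw [bump.one_of_mem_closedBall, mul_one]
  rw [mem_closedBall, dist_zero_right, Real.norm_eq_abs, abs_div, abs_of_pos scale_pos,
    div_le_iff₀ scale_pos, bump_rIn, one_mul]
  exact ht

/-- `Ω = ½` on `[-3, 3]`. [folklore] -/
theorem Ω_eq_half_of_abs_le_three {t : ℝ} (ht : |t| ≤ 3) : Ω t = 1 / 2 :=
  Ω_eq_half (ht.trans three_le_scale)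

/-- `Ω t = 0` for `|t| ≥ 2L`. [folklore] -/
theorem Ω_eq_zero {t : ℝ} (ht : 2 * scale ≤ |t|) : Ω t = 0 := by
  unfold Ω
  rw [bump.zero_of_le_dist, mul_zero]
  rw [dist_zero_right, Real.norm_eq_abs, abs_div, abs_of_pos scale_pos, le_div_iff₀ scale_pos,
    bump_rOut]
  linarith

/-- The derivative of `Ω`. [folklore] -/
theorem hasDerivAt_Ω (t : ℝ) :
    HasDerivAt Ω (1 / 2 * (deriv (bump : ℝ → ℝ) (t / scale) * (1 / scale))) t := by
  have hb : HasDerivAt (bump : ℝ → ℝ) (deriv (bump : ℝ → ℝ) (t / scale)) (t / scale) :=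
    ((bump.contDiff (n := 1)).differentiable one_ne_zero _).hasDerivAt
  have h := (hb.comp t ((hasDerivAt_id t).div_const scale)).const_mul (1 / 2)
  exact h

/-- `|Ω'| ≤ ⅛`. [folklore] -/
theorem abs_deriv_Ω_le (t : ℝ) : |deriv Ω t| ≤ 1 / 8 := by
  rw [(hasDerivAt_Ω t).deriv]
  have h1 : |deriv (bump : ℝ → ℝ) (t / scale)| ≤ derivBound := derivBound_spec.2 _
  have h2 := derivBound_div_scale_le
  rw [abs_mul, abs_mul, abs_of_pos (by norm_num : (0 : ℝ) < 1 / 2),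
    abs_of_pos (by have := scale_pos; positivity : (0 : ℝ) < 1 / scale), mul_one_div]
  calc 1 / 2 * (|deriv (bump : ℝ → ℝ) (t / scale)| / scale)
      ≤ 1 / 2 * (derivBound / scale) := by gcongr; exact scale_pos.le
    _ ≤ 1 / 2 * (1 / 4) := by gcongr
    _ = 1 / 8 := by norm_num

/-- **The slide profile** `t ↦ t + c · Ω t`: translation by `c/2` on `[-3, 3]`, the identity for
`|t| ≥ 2L`, and (for `|c| ≤ 1`) an increasing diffeomorphism of the line. [folklore] -/
def slideFun (c t : ℝ) : ℝ := t + c * Ω t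

variable {c : ℝ}

/-- The slide profile is smooth. [folklore] -/
theorem contDiff_slideFun (c : ℝ) : ContDiff ℝ ∞ (slideFun c) :=
  contDiff_id.add (contDiff_const.mul contDiff_Ω)

/-- The slide profile is continuous. [folklore] -/
theorem continuous_slideFun (c : ℝ) : Continuous (slideFun c) :=
  (contDiff_slideFun c).continuous

/-- Derivative of the slide profile. [folklore] -/
theorem hasDerivAt_slideFun (c t : ℝ) : HasDerivAt (slideFun c) (1 + c * deriv Ω t) t := by
  have h := hasDerivAt_Ω t
  rw [← h.deriv] at h
  exact (hasDerivAt_id t).add (h.const_mul c)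

/-- For `|c| ≤ 1` the derivative of the slide profile is `≥ 7/8 > 0`. [folklore] -/
theorem deriv_slideFun_pos (hc : |c| ≤ 1) (t : ℝ) : 0 < 1 + c * deriv Ω t := by
  have h1 : |c * deriv Ω t| ≤ 1 / 8 := by
    rw [abs_mul]
    calc |c| * |deriv Ω t| ≤ 1 * (1 / 8) :=
          mul_le_mul hc (abs_deriv_Ω_le t) (abs_nonneg _) zero_le_one
      _ = 1 / 8 := by norm_num
  have h2 : -|c * deriv Ω t| ≤ c * deriv Ω t := neg_abs_le _
  linarith

/-- For `|c| ≤ 1` the slide profile is strictly increasing. [folklore] -/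
theorem strictMono_slideFun (hc : |c| ≤ 1) : StrictMono (slideFun c) :=
  strictMono_of_deriv_pos fun t => by
    rw [(hasDerivAt_slideFun c t).deriv]
    exact deriv_slideFun_pos hc t

/-- The slide profile is the identity for `|t| ≥ 2L`. [folklore] -/
theorem slideFun_eq_self {t : ℝ} (ht : 2 * scale ≤ |t|) : slideFun c t = t := by
  simp [slideFun, Ω_eq_zero ht]

/-- The slide profile is the translation by `c/2` on `[-3, 3]`. [folklore] -/
theorem slideFun_eq_add {t : ℝ} (ht : |t| ≤ 3) : slideFun c t = t + c / 2 := by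
  rw [slideFun, Ω_eq_half_of_abs_le_three ht]
  ring

/-- `t - |c|/2 ≤ slideFun c t`. [folklore] -/
theorem sub_le_slideFun (c t : ℝ) : t - |c| / 2 ≤ slideFun c t := by
  have h1 : |c * Ω t| ≤ |c| / 2 := by
    rw [abs_mul, abs_of_nonneg (Ω_nonneg t)]
    have h3 : Ω t ≤ 1 / 2 := Ω_le_half t
    have h4 : 0 ≤ |c| := abs_nonneg c
    nlinarith
  have h2 : -|c * Ω t| ≤ c * Ω t := neg_abs_le _
  unfold slideFun; linarith

/-- `slideFun c t ≤ t + |c|/2`. [folklore] -/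
theorem slideFun_le_add (c t : ℝ) : slideFun c t ≤ t + |c| / 2 := by
  have h1 : |c * Ω t| ≤ |c| / 2 := by
    rw [abs_mul, abs_of_nonneg (Ω_nonneg t)]
    have h3 : Ω t ≤ 1 / 2 := Ω_le_half t
    have h4 : 0 ≤ |c| := abs_nonneg c
    nlinarith
  have h2 : c * Ω t ≤ |c * Ω t| := le_abs_self _
  unfold slideFun; linarith

/-- The slide profile is surjective. [folklore] -/
theorem surjective_slideFun (c : ℝ) : Surjective (slideFun c) := by
  refine (continuous_slideFun c).surjective ?_ ?_
  · refine tendsto_atTop_mono (sub_le_slideFun c) ?_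
    exact tendsto_atTop_add_const_right _ _ tendsto_id
  · refine tendsto_atBot_mono (slideFun_le_add c) ?_
    exact tendsto_atBot_add_const_right _ _ tendsto_id

/-- The slide profile as an order isomorphism of the line (`|c| ≤ 1`). [folklore] -/
def slideOrderIso (hc : |c| ≤ 1) : ℝ ≃o ℝ :=
  StrictMono.orderIsoOfSurjective (slideFun c) (strictMono_slideFun hc) (surjective_slideFun c)

/-- The underlying function of `slideOrderIso` is `slideFun`. [folklore] -/
@[simp] theorem coe_slideOrderIso (hc : |c| ≤ 1) : ⇑(slideOrderIso hc) = slideFun c :=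
  StrictMono.coe_orderIsoOfSurjective _ _ _

/-- The inverse of the slide profile is smooth (its derivative never vanishes). [folklore] -/
theorem contDiff_slideOrderIso_symm (hc : |c| ≤ 1) :
    ContDiff ℝ ∞ ((slideOrderIso hc).symm : ℝ → ℝ) := by
  have h := (slideOrderIso hc).toHomeomorph.contDiff_symm_deriv (n := ∞)
    (f' := fun t => 1 + c * deriv Ω t) (fun t => (deriv_slideFun_pos hc t).ne')
    (fun t => by
      rw [OrderIso.coe_toHomeomorph, coe_slideOrderIso]
      exact hasDerivAt_slideFun c t)
    (by
      rw [OrderIso.coe_toHomeomorph, coe_slideOrderIso]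
      exact contDiff_slideFun c)
  rwa [OrderIso.coe_toHomeomorph_symm] at h

/-- **The slide of the line** `t ↦ t + c · Ω t` (`|c| ≤ 1`) as a diffeomorphism of `ℝ`. [folklore] -/
def slideDiffeo (hc : |c| ≤ 1) : ℝ ≃ₘ⟮𝓘(ℝ, ℝ), 𝓘(ℝ, ℝ)⟯ ℝ where
  toEquiv := (slideOrderIso hc).toEquiv
  contMDiff_toFun := by
    change ContMDiff 𝓘(ℝ, ℝ) 𝓘(ℝ, ℝ) ∞ (slideOrderIso hc)
    rw [coe_slideOrderIso]
    exact contMDiff_iff_contDiff.2 (contDiff_slideFun c)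
  contMDiff_invFun := by
    change ContMDiff 𝓘(ℝ, ℝ) 𝓘(ℝ, ℝ) ∞ (slideOrderIso hc).symm
    exact contMDiff_iff_contDiff.2 (contDiff_slideOrderIso_symm hc)

/-- `slideDiffeo hc t = t + c · Ω t`. [folklore] -/
@[simp] theorem slideDiffeo_apply (hc : |c| ≤ 1) (t : ℝ) : slideDiffeo hc t = slideFun c t := by
  change (slideOrderIso hc) t = _
  rw [coe_slideOrderIso]

/-- The slide is strictly increasing. [folklore] -/
theorem strictMono_slideDiffeo (hc : |c| ≤ 1) : StrictMono (slideDiffeo hc) := fun a b h => by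
  simpa only [slideDiffeo_apply] using strictMono_slideFun hc h

/-- The slide is the identity for `|t| ≥ 2L`. [folklore] -/
theorem slideDiffeo_eq_self (hc : |c| ≤ 1) {t : ℝ} (ht : 2 * scale ≤ |t|) :
    slideDiffeo hc t = t := by
  rw [slideDiffeo_apply, slideFun_eq_self ht]

/-- The slide is the translation by `c/2` on `[-3, 3]`. [folklore] -/
theorem slideDiffeo_apply_of_abs_le (hc : |c| ≤ 1) {t : ℝ} (ht : |t| ≤ 3) :
    slideDiffeo hc t = t + c / 2 := by
  rw [slideDiffeo_apply, slideFun_eq_add ht]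

/-- The value of the slide at `0` is `c/2`. [folklore] -/
theorem slideDiffeo_zero (hc : |c| ≤ 1) : slideDiffeo hc 0 = c / 2 := by
  rw [slideDiffeo_apply_of_abs_le hc (by norm_num), zero_add]

/-- `t - ½ ≤ slideDiffeo hc t ≤ t + ½`. [folklore] -/
theorem sub_half_le_slideDiffeo (hc : |c| ≤ 1) (t : ℝ) : t - 1 / 2 ≤ slideDiffeo hc t := by
  rw [slideDiffeo_apply]
  have := sub_le_slideFun c t
  linarith

/-- `slideDiffeo hc t ≤ t + ½`. [folklore] -/
theorem slideDiffeo_le_add_half (hc : |c| ≤ 1) (t : ℝ) : slideDiffeo hc t ≤ t + 1 / 2 := by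
  rw [slideDiffeo_apply]
  have := slideFun_le_add c t
  linarith

end NeckSlide

/-! ### Neck slides: diffeomorphisms of `P` supported in a neck `ψ : S × ℝ → P` -/

section NeckSlideFun

variable {S P : Type*}

/-- The map underlying a neck slide: reparametrise the `ℝ`-coordinate of the neck
`ψ : S × ℝ → P` by `μ : ℝ → ℝ`, and fix every point off the neck. [folklore] -/
def neckSlideFun (ψ : S × ℝ → P) (μ : ℝ → ℝ) (p : P) : P := by
  classical
  exact if h : p ∈ range ψ then ψ ((h.choose).1, μ (h.choose).2) else p

/-- On the neck, the slide reparametrises the `ℝ`-coordinate. [folklore] -/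
theorem neckSlideFun_apply {ψ : S × ℝ → P} (hinj : Injective ψ) (μ : ℝ → ℝ) (q : S × ℝ) :
    neckSlideFun ψ μ (ψ q) = ψ (q.1, μ q.2) := by
  classical
  have h : ψ q ∈ range ψ := mem_range_self q
  unfold neckSlideFun
  rw [dif_pos h, hinj h.choose_spec]

/-- Off the neck, the slide is the identity. [folklore] -/
theorem neckSlideFun_of_not_mem {ψ : S × ℝ → P} (μ : ℝ → ℝ) {p : P} (hp : p ∉ range ψ) :
    neckSlideFun ψ μ p = p := by
  classical
  unfold neckSlideFun
  rw [dif_neg hp]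

end NeckSlideFun

section NeckSlide

variable {ES HS : Type*} [NormedAddCommGroup ES] [NormedSpace ℝ ES] [TopologicalSpace HS]
  {IS : ModelWithCorners ℝ ES HS} {S : Type*} [TopologicalSpace S] [ChartedSpace HS S]
  {EP HP : Type*} [NormedAddCommGroup EP] [NormedSpace ℝ EP] [TopologicalSpace HP]
  {IP : ModelWithCorners ℝ EP HP} {P : Type*} [TopologicalSpace P] [ChartedSpace HP P]

/-- **Smoothness of neck slides.** If `ψ : S × ℝ → P` is a smooth embedding with open range of
a compact `S` times the line into a Hausdorff manifold, and `μ : ℝ → ℝ` is smooth and equal to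
the identity for `|t| ≥ T`, then the slide is smooth: on the (open) neck it is
`ψ ∘ (id × μ) ∘ ψ⁻¹` with `ψ⁻¹` smooth on the range (`Literature.Topology.FourManifolds.contMDiffOn_leftInverse_of_isImmersion`),
and off the compact, hence closed, set `ψ (S × [-T, T])` it is the identity. [folklore] -/
theorem contMDiff_neckSlideFun [T2Space P] [CompactSpace S] {ψ : S × ℝ → P}
    (hψ : Manifold.IsSmoothEmbedding (IS.prod 𝓘(ℝ, ℝ)) IP ∞ ψ) (hψo : IsOpen (range ψ))
    {μ : ℝ → ℝ} (hμ : ContDiff ℝ ∞ μ) {T : ℝ} (hμT : ∀ t, T ≤ |t| → μ t = t) :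
    ContMDiff IP IP ∞ (neckSlideFun ψ μ) := by
  have hinj : Injective ψ := hψ.isEmbedding.injective
  intro p
  by_cases hp : p ∈ range ψ
  · obtain ⟨q₀, rfl⟩ := hp
    haveI : Nonempty (S × ℝ) := ⟨q₀⟩
    have hg : ContMDiffOn IP (IS.prod 𝓘(ℝ, ℝ)) ∞ (invFun ψ) (range ψ) :=
      contMDiffOn_leftInverse_of_isImmersion hψ.isImmersion hψ.isEmbedding
        (leftInverse_invFun hinj)
    have h1 : ContMDiff (IS.prod 𝓘(ℝ, ℝ)) (IS.prod 𝓘(ℝ, ℝ)) ∞ (Prod.map id μ) :=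
      (contMDiff_id : ContMDiff IS IS ∞ (id : S → S)).prodMap (contMDiff_iff_contDiff.2 hμ)
    have h2 : ContMDiffOn IP IP ∞ (fun p => ψ (Prod.map id μ (invFun ψ p))) (range ψ) :=
      (hψ.contMDiff.comp h1).comp_contMDiffOn hg
    have h3 : (fun p => ψ (Prod.map id μ (invFun ψ p))) =ᶠ[𝓝 (ψ q₀)] neckSlideFun ψ μ := by
      filter_upwards [hψo.mem_nhds (mem_range_self q₀)] with p hp
      obtain ⟨q, rfl⟩ := hp
      rw [neckSlideFun_apply hinj, leftInverse_invFun hinj q]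
      rfl
    exact (h2.contMDiffAt (hψo.mem_nhds (mem_range_self q₀))).congr_of_eventuallyEq h3.symm
  · have hK : IsCompact (ψ '' (univ ×ˢ Icc (-T) T)) :=
      (isCompact_univ.prod isCompact_Icc).image hψ.contMDiff.continuous
    have hpK : p ∉ ψ '' (univ ×ˢ Icc (-T) T) := fun h => hp (image_subset_range _ _ h)
    have h3 : neckSlideFun ψ μ =ᶠ[𝓝 p] id := by
      filter_upwards [hK.isClosed.isOpen_compl.mem_nhds hpK] with p' hp'
      by_cases hp'r : p' ∈ range ψ
      · obtain ⟨⟨θ, t⟩, rfl⟩ := hp'r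
        have ht : T ≤ |t| := by
          by_contra h
          push Not at h
          exact hp' ⟨(θ, t), ⟨mem_univ _, ⟨(abs_lt.1 h).1.le, (abs_lt.1 h).2.le⟩⟩, rfl⟩
        rw [neckSlideFun_apply hinj, id]
        change ψ (θ, μ t) = ψ (θ, t)
        rw [hμT t ht]
      · exact neckSlideFun_of_not_mem μ hp'r
    exact contMDiffAt_id.congr_of_eventuallyEq h3

/-- **Neck slides.** Let `ψ : S × ℝ → P` be a smooth embedding with open range (`S` compact, `P`
Hausdorff) and `μ` a diffeomorphism of `ℝ` equal to the identity for `|t| ≥ T`. Then there is a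
diffeomorphism `Φ` of `P` with `Φ (ψ (θ, t)) = ψ (θ, μ t)` which is the identity off the neck
(its inverse is the slide by `μ⁻¹`). This is the flow-box picture "push along the `ℝ`-factor of
a product neighbourhood, cut off at both ends". [folklore] -/
theorem exists_neckSlide [T2Space P] [CompactSpace S] {ψ : S × ℝ → P}
    (hψ : Manifold.IsSmoothEmbedding (IS.prod 𝓘(ℝ, ℝ)) IP ∞ ψ) (hψo : IsOpen (range ψ))
    (μ : ℝ ≃ₘ⟮𝓘(ℝ, ℝ), 𝓘(ℝ, ℝ)⟯ ℝ) (T : ℝ) (hμT : ∀ t, T ≤ |t| → μ t = t) :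
    ∃ Φ : P ≃ₘ⟮IP, IP⟯ P, (∀ q : S × ℝ, Φ (ψ q) = ψ (q.1, μ q.2)) ∧ ∀ p, p ∉ range ψ → Φ p = p := by
  have hinj : Injective ψ := hψ.isEmbedding.injective
  have hμ : ContDiff ℝ ∞ μ := contMDiff_iff_contDiff.1 μ.contMDiff
  have hμs : ContDiff ℝ ∞ μ.symm := contMDiff_iff_contDiff.1 μ.symm.contMDiff
  have hμsT : ∀ t, T ≤ |t| → μ.symm t = t := fun t ht =>
    calc μ.symm t = μ.symm (μ t) := by rw [hμT t ht]
      _ = t := μ.symm_apply_apply t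
  have hleft : ∀ (ν ν' : ℝ → ℝ), (∀ t, ν' (ν t) = t) →
      LeftInverse (neckSlideFun ψ ν') (neckSlideFun ψ ν) := by
    intro ν ν' h p
    by_cases hp : p ∈ range ψ
    · obtain ⟨q, rfl⟩ := hp
      rw [neckSlideFun_apply hinj, neckSlideFun_apply hinj]
      change ψ (q.1, ν' (ν q.2)) = ψ q
      rw [h]
    · rw [neckSlideFun_of_not_mem ν hp, neckSlideFun_of_not_mem ν' hp]
  let e : P ≃ P :=
    { toFun := neckSlideFun ψ μ
      invFun := neckSlideFun ψ μ.symm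
      left_inv := hleft μ μ.symm μ.symm_apply_apply
      right_inv := hleft μ.symm μ μ.apply_symm_apply }
  refine ⟨{ toEquiv := e
            contMDiff_toFun := contMDiff_neckSlideFun hψ hψo hμ hμT
            contMDiff_invFun := contMDiff_neckSlideFun hψ hψo hμs hμsT }, fun q => ?_,
    fun p hp => ?_⟩
  · exact neckSlideFun_apply hinj μ q
  · exact neckSlideFun_of_not_mem μ hp

end NeckSlide

/-! ### Open smooth embeddings as diffeomorphisms onto open submanifolds -/

section OntoOpens

variable {EA HA : Type*} [NormedAddCommGroup EA] [NormedSpace ℝ EA] [TopologicalSpace HA]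
  {IA : ModelWithCorners ℝ EA HA} {A : Type*} [TopologicalSpace A] [ChartedSpace HA A]
  {EM HM : Type*} [NormedAddCommGroup EM] [NormedSpace ℝ EM] [TopologicalSpace HM]
  {IM : ModelWithCorners ℝ EM HM} {M : Type*} [TopologicalSpace M] [ChartedSpace HM M]

/-- **An open smooth embedding is a diffeomorphism onto its range**, the range being presented
as any open subset `U` of the target with carrier `range k` (this flexibility — rather than the
literal `⟨range k, _⟩` of `Literature.Topology.FourManifolds.rangeDiffeomorph` in `SmoothOrientationGluing.lean`, which this
generalises with the same proof — lets the punctured piece `M ∖ {c 0}` of a connected sum be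
presented by an arbitrary manifold `A`). The inverse is `C^∞` because a left inverse of an
injective immersion which is a topological embedding is `C^∞` on the range
(`Literature.Topology.FourManifolds.contMDiffOn_leftInverse_of_isImmersion`; Lee, *Introduction to Smooth Manifolds*,
Prop. 5.2). [folklore] -/
def diffeomorphOntoOpens {k : A → M} (hk : Manifold.IsSmoothEmbedding IA IM ∞ k)
    (U : TopologicalSpace.Opens M) (hU : (U : Set M) = range k) : A ≃ₘ⟮IA, IM⟯ U :=
  haveI hmem : ∀ u : U, ∃ a, k a = (u : M) := fun u => by
    have h : (u : M) ∈ (U : Set M) := u.2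
    rwa [hU] at h
  haveI hmem' : ∀ a : A, k a ∈ U := fun a => by
    have h : k a ∈ range k := mem_range_self a
    rw [← hU] at h
    exact h
  haveI hsm : ContMDiff IM IA ∞ (fun u : U => (hmem u).choose) := by
    intro u
    obtain ⟨a₀, -⟩ := hmem u
    haveI : Nonempty A := ⟨a₀⟩
    have hg : ContMDiffOn IM IA ∞ (invFun k) (range k) :=
      contMDiffOn_leftInverse_of_isImmersion hk.isImmersion hk.isEmbedding
        (leftInverse_invFun hk.isEmbedding.injective)
    have heq : (fun u : U => (hmem u).choose) = invFun k ∘ Subtype.val := by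
      funext u
      apply hk.isEmbedding.injective
      rw [(hmem u).choose_spec, comp_apply, invFun_eq (hmem u)]
    rw [heq]
    exact (hg.comp_contMDiff contMDiff_subtype_val fun u => (hU ▸ u.2 : (u : M) ∈ range k)) u
  { toFun := fun a => ⟨k a, hmem' a⟩
    invFun := fun u => (hmem u).choose
    left_inv := fun a => hk.isEmbedding.injective (hmem ⟨k a, hmem' a⟩).choose_spec
    right_inv := fun u => Subtype.ext (hmem u).choose_spec
    contMDiff_toFun := (ContMDiff.subtypeVal_comp_iff U _).1 hk.contMDiff
    contMDiff_invFun := hsm }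

/-- `diffeomorphOntoOpens hk U hU` acts as `k`. [folklore] -/
@[simp] theorem coe_diffeomorphOntoOpens_apply {k : A → M}
    (hk : Manifold.IsSmoothEmbedding IA IM ∞ k) (U : TopologicalSpace.Opens M)
    (hU : (U : Set M) = range k) (a : A) : ((diffeomorphOntoOpens hk U hU a : U) : M) = k a :=
  rfl

/-- `k` inverts `(diffeomorphOntoOpens hk U hU).symm` on `U`. [folklore] -/
theorem apply_diffeomorphOntoOpens_symm {k : A → M}
    (hk : Manifold.IsSmoothEmbedding IA IM ∞ k) (U : TopologicalSpace.Opens M)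
    (hU : (U : Set M) = range k) (u : U) : k ((diffeomorphOntoOpens hk U hU).symm u) = u := by
  conv_rhs => rw [← (diffeomorphOntoOpens hk U hU).apply_symm_apply u]
  rfl

end OntoOpens

/-! ### Neck presentations of connected sums -/

section Main

variable {E : Type*} [NormedAddCommGroup E] [InnerProductSpace ℝ E] {n : ℕ}
  [Fact (finrank ℝ E = n + 1)]
  {HP : Type*} [TopologicalSpace HP] {IP : ModelWithCorners ℝ E HP}
  {P : Type*} [TopologicalSpace P] [ChartedSpace HP P]
  {EM HM : Type*} [NormedAddCommGroup EM] [NormedSpace ℝ EM] [TopologicalSpace HM]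
  {IM : ModelWithCorners ℝ EM HM}
  {M₁ : Type*} [TopologicalSpace M₁] [T2Space M₁] [ChartedSpace HM M₁]
  {EN HN : Type*} [NormedAddCommGroup EN] [NormedSpace ℝ EN] [TopologicalSpace HN]
  {IN : ModelWithCorners ℝ EN HN}
  {M₂ : Type*} [TopologicalSpace M₂] [T2Space M₂] [ChartedSpace HN M₂]

/-- **Neck presentation ⇒ open gluing along the connected-sum relation.** Let `P` (Hausdorff,
modelled on the real inner product space `E` of dimension `n + 1`) contain a neck
`ψ : Sⁿ × ℝ → P` (a smooth embedding with open range), and let `e₁ : M₁ ∖ {c₁ 0} → P`,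
`e₂ : M₂ ∖ {c₂ 0} → P` be smooth embeddings with open disjoint ranges missing the middle sphere
`ψ (Sⁿ × {0})`, covering `P` together with it, and matching the punctured discs with the two
half-necks in polar coordinates, `e₁ (c₁ (t • θ)) = ψ (θ, t)`, `e₂ (c₂ (t • θ)) = ψ (θ, -t)`
(`t > 0`). Then `P` is the open gluing of `M₁ ∖ {c₁ 0}` and `M₂ ∖ {c₂ 0}` along
Kervaire–Milnor's relation `c₁ (t • u) ∼ c₂ ((1 - t) • u)` — "joining two manifolds by a tube is
the connected sum" (Kosinski VI §1, p. 90 and Prop. 1.3; Hamilton 1997, p. 4; Chen–Zhu 2006,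
arXiv p. 25). The gluing maps are `Φ₋ ∘ e₁`, `Φ₊ ∘ e₂` for the neck slides `Φ∓` by `t ∓ Ω t`.
[cite: Kosinski1993, Ch. VI §1 (p. 90; Prop. 1.3)] -/
theorem isOpenGluing_connectedSumRel_of_neck [T2Space P] [IsManifold IP ∞ P]
    (c₁ : E → M₁) (c₂ : E → M₂)
    {ψ : sphere (0 : E) 1 × ℝ → P}
    (hψ : Manifold.IsSmoothEmbedding ((𝓡 n).prod 𝓘(ℝ, ℝ)) IP ∞ ψ) (hψo : IsOpen (range ψ))
    {e₁ : puncture c₁ → P} (he₁ : Manifold.IsSmoothEmbedding IM IP ∞ e₁)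
    (he₁o : IsOpen (range e₁))
    {e₂ : puncture c₂ → P} (he₂ : Manifold.IsSmoothEmbedding IN IP ∞ e₂)
    (he₂o : IsOpen (range e₂))
    (hdisj : Disjoint (range e₁) (range e₂))
    (h0₁ : ∀ θ, ψ (θ, 0) ∉ range e₁) (h0₂ : ∀ θ, ψ (θ, 0) ∉ range e₂)
    (hcover : ∀ p, p ∉ range e₁ → p ∉ range e₂ → ∃ θ, ψ (θ, 0) = p)
    (hc₁ : ∀ (θ : sphere (0 : E) 1) (t : ℝ), 0 < t →
      ∃ a : puncture c₁, (a : M₁) = c₁ (t • (θ : E)) ∧ e₁ a = ψ (θ, t))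
    (hc₂ : ∀ (θ : sphere (0 : E) 1) (t : ℝ), 0 < t →
      ∃ b : puncture c₂, (b : M₂) = c₂ (t • (θ : E)) ∧ e₂ b = ψ (θ, -t)) :
    IsOpenGluing IM IN IP (A := puncture c₁) (B := puncture c₂) (P := P)
      (connectedSumRel c₁ c₂) := by
  haveI : FiniteDimensional ℝ E := .of_fact_finrank_eq_succ (K := ℝ) (V := E) n
  have hinj : Injective ψ := hψ.isEmbedding.injective
  have hc1 : |(-1 : ℝ)| ≤ 1 := by norm_num
  have hc1' : |(1 : ℝ)| ≤ 1 := by norm_num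
  -- the two slides of the line and of `P`
  set μ₁ := NeckSlide.slideDiffeo hc1 with hμ₁
  set μ₂ := NeckSlide.slideDiffeo hc1' with hμ₂
  obtain ⟨Φ₁, hΦ₁ψ, hΦ₁id⟩ := exists_neckSlide hψ hψo μ₁ (2 * NeckSlide.scale)
    (fun t ht => NeckSlide.slideDiffeo_eq_self hc1 ht)
  obtain ⟨Φ₂, hΦ₂ψ, hΦ₂id⟩ := exists_neckSlide hψ hψo μ₂ (2 * NeckSlide.scale)
    (fun t ht => NeckSlide.slideDiffeo_eq_self hc1' ht)
  -- values of the line slides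
  have hμ₁v : ∀ t, |t| ≤ 3 → μ₁ t = t - 1 / 2 := fun t ht => by
    rw [hμ₁, NeckSlide.slideDiffeo_apply_of_abs_le hc1 ht]; ring
  have hμ₂v : ∀ t, |t| ≤ 3 → μ₂ t = t + 1 / 2 := fun t ht => by
    rw [hμ₂, NeckSlide.slideDiffeo_apply_of_abs_le hc1' ht]
  have hμ₁0 : μ₁ 0 = -(1 / 2) := by rw [hμ₁v 0 (by norm_num)]; ring
  have hμ₂0 : μ₂ 0 = 1 / 2 := by rw [hμ₂v 0 (by norm_num)]; ring
  -- where `e₁`, `e₂` can meet the neck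
  have he₁ψ : ∀ a θ t, e₁ a = ψ (θ, t) → 0 < t := by
    intro a θ t h
    rcases lt_trichotomy t 0 with ht | rfl | ht
    · obtain ⟨b, -, hb⟩ := hc₂ θ (-t) (by linarith)
      rw [neg_neg] at hb
      exact absurd (hb.trans h.symm ▸ mem_range_self (f := e₂) b)
        (Set.disjoint_left.1 hdisj (mem_range_self a))
    · exact absurd (h ▸ mem_range_self (f := e₁) a) (h0₁ θ)
    · exact ht
  have he₂ψ : ∀ b θ t, e₂ b = ψ (θ, t) → t < 0 := by
    intro b θ t h
    rcases lt_trichotomy t 0 with ht | rfl | ht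
    · exact ht
    · exact absurd (h ▸ mem_range_self (f := e₂) b) (h0₂ θ)
    · obtain ⟨a, -, ha⟩ := hc₁ θ t ht
      exact absurd (h ▸ mem_range_self (f := e₂) b)
        (Set.disjoint_left.1 hdisj (ha ▸ mem_range_self (f := e₁) a))
  have he₁c : ∀ (a : puncture c₁) (θ : sphere (0 : E) 1) (t : ℝ), 0 < t → e₁ a = ψ (θ, t) →
      (a : M₁) = c₁ (t • (θ : E)) := by
    intro a θ t ht h
    obtain ⟨a', ha', he'⟩ := hc₁ θ t ht
    rw [← he₁.isEmbedding.injective (he'.trans h.symm), ha']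
  have he₂c : ∀ (b : puncture c₂) (θ : sphere (0 : E) 1) (t : ℝ), 0 < t → e₂ b = ψ (θ, -t) →
      (b : M₂) = c₂ (t • (θ : E)) := by
    intro b θ t ht h
    obtain ⟨b', hb', he'⟩ := hc₂ θ t ht
    rw [← he₂.isEmbedding.injective (he'.trans h.symm), hb']
  refine ⟨Φ₁ ∘ e₁, Φ₂ ∘ e₂, he₁.diffeomorph_comp Φ₁, ?_, he₂.diffeomorph_comp Φ₂, ?_, ?_, ?_⟩
  · rw [range_comp]; exact Φ₁.toHomeomorph.isOpenMap _ he₁o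
  · rw [range_comp]; exact Φ₂.toHomeomorph.isOpenMap _ he₂o
  · -- the two ranges cover `P`
    refine eq_univ_of_forall fun p => ?_
    by_cases hp : p ∈ range ψ
    · obtain ⟨⟨θ, τ⟩, rfl⟩ := hp
      by_cases hτ : -(1 / 2) < τ
      · -- in the range of `Φ₁ ∘ e₁`
        left
        set s := μ₁.symm τ with hs
        have hμs : μ₁ s = τ := μ₁.apply_symm_apply τ
        have hs0 : 0 < s := by
          by_contra h
          push Not at h
          have := (NeckSlide.strictMono_slideDiffeo hc1).monotone h
          rw [← hμ₁] at this
          rw [hμs, hμ₁0] at this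
          linarith
        obtain ⟨a, -, ha⟩ := hc₁ θ s hs0
        refine ⟨a, ?_⟩
        change Φ₁ (e₁ a) = _
        rw [ha, hΦ₁ψ]
        change ψ (θ, μ₁ s) = ψ (θ, τ)
        rw [hμs]
      · -- in the range of `Φ₂ ∘ e₂`
        right
        push Not at hτ
        set s := μ₂.symm τ with hs
        have hμs : μ₂ s = τ := μ₂.apply_symm_apply τ
        have hs0 : s < 0 := by
          by_contra h
          push Not at h
          have := (NeckSlide.strictMono_slideDiffeo hc1').monotone h
          rw [← hμ₂] at this
          rw [hμs, hμ₂0] at this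
          linarith
        obtain ⟨b, -, hb⟩ := hc₂ θ (-s) (by linarith)
        refine ⟨b, ?_⟩
        change Φ₂ (e₂ b) = _
        rw [hb, hΦ₂ψ, neg_neg]
        change ψ (θ, μ₂ s) = ψ (θ, τ)
        rw [hμs]
    · rcases em (p ∈ range e₁) with ⟨a, rfl⟩ | h₁
      · exact Or.inl ⟨a, by change Φ₁ (e₁ a) = e₁ a; exact hΦ₁id _ hp⟩
      rcases em (p ∈ range e₂) with ⟨b, rfl⟩ | h₂
      · exact Or.inr ⟨b, by change Φ₂ (e₂ b) = e₂ b; exact hΦ₂id _ hp⟩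
      obtain ⟨θ, rfl⟩ := hcover p h₁ h₂
      exact absurd (mem_range_self _) hp
  · -- the gluing relation is Kervaire–Milnor's
    intro a b
    constructor
    · intro hab
      change Φ₁ (e₁ a) = Φ₂ (e₂ b) at hab
      -- `e₁ a` lies on the neck
      have ha : e₁ a ∈ range ψ := by
        by_contra ha
        rw [hΦ₁id _ ha] at hab
        by_cases hb : e₂ b ∈ range ψ
        · obtain ⟨q, hq⟩ := hb
          rw [← hq, hΦ₂ψ] at hab
          exact ha (hab ▸ mem_range_self _)
        · rw [hΦ₂id _ hb] at hab
          exact Set.disjoint_left.1 hdisj (mem_range_self a) (hab ▸ mem_range_self b)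
      obtain ⟨⟨θ, t⟩, hq⟩ := ha
      have ht : 0 < t := he₁ψ a θ t hq.symm
      -- so does `e₂ b`
      have hb : e₂ b ∈ range ψ := by
        by_contra hb
        rw [hΦ₂id _ hb, ← hq, hΦ₁ψ] at hab
        exact hb (hab ▸ mem_range_self _)
      obtain ⟨⟨θ', s⟩, hq'⟩ := hb
      have hs : s < 0 := he₂ψ b θ' s hq'.symm
      rw [← hq, ← hq', hΦ₁ψ, hΦ₂ψ] at hab
      have hab' := hinj hab
      simp only [Prod.mk.injEq] at hab'
      obtain ⟨rfl, hts⟩ := hab'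
      -- the common height `τ` lies in `(-½, ½)`
      have hτ₁ : -(1 / 2) < μ₁ t := by
        have := NeckSlide.sub_half_le_slideDiffeo hc1 t
        rw [← hμ₁] at this
        linarith
      have hτ₂ : μ₂ s < 1 / 2 := by
        have := NeckSlide.slideDiffeo_le_add_half hc1' s
        rw [← hμ₂] at this
        linarith
      set τ := μ₁ t with hτ
      have ht' : t = τ + 1 / 2 := by
        apply (NeckSlide.strictMono_slideDiffeo hc1).injective
        rw [← hμ₁, ← hτ, hμ₁v (τ + 1 / 2) (by rw [abs_le]; constructor <;> linarith)]
        ring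
      have hs' : s = τ - 1 / 2 := by
        apply (NeckSlide.strictMono_slideDiffeo hc1').injective
        rw [← hμ₂, ← hts, hμ₂v (τ - 1 / 2) (by rw [abs_le]; constructor <;> linarith)]
        ring
      refine ⟨θ, t, mem_sphere_zero_iff_norm.1 θ.2, ⟨ht, by linarith⟩, he₁c a θ t ht hq.symm, ?_⟩
      refine he₂c b θ (1 - t) (by linarith) ?_
      rw [← hq']
      congr 2
      linarith
    · rintro ⟨u, t, hu, ht, ha, hb⟩
      set θ : sphere (0 : E) 1 := ⟨u, mem_sphere_zero_iff_norm.2 hu⟩ with hθ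
      obtain ⟨a', ha', hea⟩ := hc₁ θ t ht.1
      have haa : a' = a := Subtype.ext (ha'.trans ha.symm)
      obtain ⟨b', hb', heb⟩ := hc₂ θ (1 - t) (by linarith [ht.2])
      have hbb : b' = b := Subtype.ext (hb'.trans hb.symm)
      subst haa hbb
      change Φ₁ (e₁ a') = Φ₂ (e₂ b')
      rw [hea, heb, hΦ₁ψ, hΦ₂ψ]
      change ψ (θ, μ₁ t) = ψ (θ, μ₂ (-(1 - t)))
      rw [hμ₁v t (by rw [abs_le]; constructor <;> linarith [ht.1, ht.2]),
        hμ₂v (-(1 - t)) (by rw [abs_le]; constructor <;> linarith [ht.1, ht.2])]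
      congr 2
      ring

/-- **A manifold with a neck presentation is a connected sum** (Kosinski, *Differential
Manifolds*, VI §1, p. 90: "connected sum is the operation of joining two manifolds by a tube";
used in Hamilton 1997, p. 4 and Chen–Zhu 2006, arXiv p. 25, to recover a manifold from the
pieces of a surgery along necks as a connected sum). If moreover the discs `c₁ : E → M₁`,
`c₂ : E → M₂` are smooth embeddings, then `P` is a connected sum `M₁ # M₂` in the sense of
`Literature.Topology.FourManifolds.IsConnectedSum`, with these very discs. [cite: Kosinski1993, Ch. VI §1 (p. 90; Prop. 1.3)] -/
theorem isConnectedSum_of_neck [T2Space P] [IsManifold IP ∞ P]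
    {c₁ : E → M₁} {c₂ : E → M₂}
    (hce₁ : Manifold.IsSmoothEmbedding 𝓘(ℝ, E) IM ∞ c₁)
    (hce₂ : Manifold.IsSmoothEmbedding 𝓘(ℝ, E) IN ∞ c₂)
    {ψ : sphere (0 : E) 1 × ℝ → P}
    (hψ : Manifold.IsSmoothEmbedding ((𝓡 n).prod 𝓘(ℝ, ℝ)) IP ∞ ψ) (hψo : IsOpen (range ψ))
    {e₁ : puncture c₁ → P} (he₁ : Manifold.IsSmoothEmbedding IM IP ∞ e₁)
    (he₁o : IsOpen (range e₁))
    {e₂ : puncture c₂ → P} (he₂ : Manifold.IsSmoothEmbedding IN IP ∞ e₂)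
    (he₂o : IsOpen (range e₂))
    (hdisj : Disjoint (range e₁) (range e₂))
    (h0₁ : ∀ θ, ψ (θ, 0) ∉ range e₁) (h0₂ : ∀ θ, ψ (θ, 0) ∉ range e₂)
    (hcover : ∀ p, p ∉ range e₁ → p ∉ range e₂ → ∃ θ, ψ (θ, 0) = p)
    (hc₁ : ∀ (θ : sphere (0 : E) 1) (t : ℝ), 0 < t →
      ∃ a : puncture c₁, (a : M₁) = c₁ (t • (θ : E)) ∧ e₁ a = ψ (θ, t))
    (hc₂ : ∀ (θ : sphere (0 : E) 1) (t : ℝ), 0 < t →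
      ∃ b : puncture c₂, (b : M₂) = c₂ (t • (θ : E)) ∧ e₂ b = ψ (θ, -t)) :
    IsConnectedSum IP IM IN M₁ M₂ P :=
  ⟨c₁, c₂, hce₁, hce₂, isOpenGluing_connectedSumRel_of_neck c₁ c₂ hψ hψo he₁ he₁o he₂ he₂o hdisj
    h0₁ h0₂ hcover hc₁ hc₂⟩

/-- **A manifold with a neck presentation is a connected sum — pieces presented by arbitrary
manifolds.** The same statement as `isConnectedSum_of_neck`, with the punctured summands
`M₁ ∖ {c₁ 0}`, `M₂ ∖ {c₂ 0}` presented by arbitrary manifolds `A₁`, `A₂` through open smooth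
embeddings `k₁ : A₁ → M₁`, `k₂ : A₂ → M₂` with ranges `{c₁ 0}ᶜ`, `{c₂ 0}ᶜ`, and the embeddings
`e₁ : A₁ → P`, `e₂ : A₂ → P` into `P`. This is the form produced by a gluing (pushout)
construction of the capped pieces `M₁ = A₁ ∪ (disc)`, `M₂ = A₂ ∪ (disc)` of a surgery along the
neck, where `A₁`, `A₂` are the two sides of the middle sphere in `P`, `k₁`, `k₂`, `c₁`, `c₂` the
structure maps of the pushouts and `e₁`, `e₂` the inclusions (Kosinski VI §1, §9; Hamilton 1997,
p. 4: "replacing two `B⁴`'s with an `S³ × B¹`"). [cite: Kosinski1993, Ch. VI §1 (p. 90; Prop. 1.3)] -/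
theorem isConnectedSum_of_neck' [T2Space P] [IsManifold IP ∞ P]
    [IsManifold IM ∞ M₁] [IsManifold IN ∞ M₂]
    {A₁ : Type*} [TopologicalSpace A₁] [ChartedSpace HM A₁] [IsManifold IM ∞ A₁]
    {A₂ : Type*} [TopologicalSpace A₂] [ChartedSpace HN A₂] [IsManifold IN ∞ A₂]
    {c₁ : E → M₁} {c₂ : E → M₂}
    (hce₁ : Manifold.IsSmoothEmbedding 𝓘(ℝ, E) IM ∞ c₁)
    (hce₂ : Manifold.IsSmoothEmbedding 𝓘(ℝ, E) IN ∞ c₂)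
    {k₁ : A₁ → M₁} (hk₁ : Manifold.IsSmoothEmbedding IM IM ∞ k₁) (hk₁r : range k₁ = {c₁ 0}ᶜ)
    {k₂ : A₂ → M₂} (hk₂ : Manifold.IsSmoothEmbedding IN IN ∞ k₂) (hk₂r : range k₂ = {c₂ 0}ᶜ)
    {ψ : sphere (0 : E) 1 × ℝ → P}
    (hψ : Manifold.IsSmoothEmbedding ((𝓡 n).prod 𝓘(ℝ, ℝ)) IP ∞ ψ) (hψo : IsOpen (range ψ))
    {e₁ : A₁ → P} (he₁ : Manifold.IsSmoothEmbedding IM IP ∞ e₁) (he₁o : IsOpen (range e₁))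
    {e₂ : A₂ → P} (he₂ : Manifold.IsSmoothEmbedding IN IP ∞ e₂) (he₂o : IsOpen (range e₂))
    (hdisj : Disjoint (range e₁) (range e₂))
    (h0₁ : ∀ θ, ψ (θ, 0) ∉ range e₁) (h0₂ : ∀ θ, ψ (θ, 0) ∉ range e₂)
    (hcover : ∀ p, p ∉ range e₁ → p ∉ range e₂ → ∃ θ, ψ (θ, 0) = p)
    (hc₁ : ∀ (θ : sphere (0 : E) 1) (t : ℝ), 0 < t →
      ∃ a : A₁, k₁ a = c₁ (t • (θ : E)) ∧ e₁ a = ψ (θ, t))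
    (hc₂ : ∀ (θ : sphere (0 : E) 1) (t : ℝ), 0 < t →
      ∃ b : A₂, k₂ b = c₂ (t • (θ : E)) ∧ e₂ b = ψ (θ, -t)) :
    IsConnectedSum IP IM IN M₁ M₂ P := by
  -- identify `A₁`, `A₂` with the punctured pieces
  set δ₁ := diffeomorphOntoOpens hk₁ (puncture c₁) hk₁r.symm with hδ₁
  set δ₂ := diffeomorphOntoOpens hk₂ (puncture c₂) hk₂r.symm with hδ₂
  have he₁' : Manifold.IsSmoothEmbedding IM IP ∞ (e₁ ∘ δ₁.symm) := he₁.comp_diffeomorph δ₁.symm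
  have he₂' : Manifold.IsSmoothEmbedding IN IP ∞ (e₂ ∘ δ₂.symm) := he₂.comp_diffeomorph δ₂.symm
  have hr₁ : range (e₁ ∘ δ₁.symm) = range e₁ := δ₁.symm.surjective.range_comp e₁
  have hr₂ : range (e₂ ∘ δ₂.symm) = range e₂ := δ₂.symm.surjective.range_comp e₂
  refine isConnectedSum_of_neck hce₁ hce₂ hψ hψo he₁' (hr₁ ▸ he₁o) he₂' (hr₂ ▸ he₂o)
    (by rw [hr₁, hr₂]; exact hdisj) (fun θ => hr₁ ▸ h0₁ θ) (fun θ => hr₂ ▸ h0₂ θ)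
    (fun p h₁ h₂ => hcover p (hr₁ ▸ h₁) (hr₂ ▸ h₂)) (fun θ t ht => ?_) (fun θ t ht => ?_)
  · obtain ⟨a, hka, hea⟩ := hc₁ θ t ht
    refine ⟨δ₁ a, ?_, ?_⟩
    · rw [← hka]; rfl
    · change e₁ (δ₁.symm (δ₁ a)) = _
      rw [δ₁.symm_apply_apply, hea]
  · obtain ⟨b, hkb, heb⟩ := hc₂ θ t ht
    refine ⟨δ₂ b, ?_, ?_⟩
    · rw [← hkb]; rfl
    · change e₂ (δ₂.symm (δ₂ b)) = _
      rw [δ₂.symm_apply_apply, heb]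

end Main

end Literature.Topology.FourManifolds
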